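import Literature.Geometry.Kaehler.ComplexTorusEndomorphismFieldEigenspaces
import Literature.Geometry.Kaehler.ComplexTorusHodgeLieAlgebraCommutant
import Literature.Geometry.Kaehler.ComplexTorusHodgeGroupBorelEmbedding
import Literature.Algebra.Lie.TraceSeparatingCenterDerived
import HarnessLib

/-!
# Zarhin's Theorem 2.3: for a subfield `E ⊇ 𝒞_X` of `End⁰(X)`, the multiplicities `(n_σ)_{σ ∈ Σ_E}` lie in
# `𝒞_X ⊗_ℚ ℂ` — `n_σ` depends only on `σ|_{𝒞_X}` (Zarhin, *The endomorphism rings of jacobians of cyclic covers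
# of the projective line*, Math. Proc. Cambridge Philos. Soc. 136 (2004), Thm. 2.3, FIRST ASSERTION, at torus
# level, by the printed Hodge-Lie-algebra proof)

Layer `Literature/Geometry/Kaehler`, namespace `Literature.Geometry.Kaehler.ComplexTorus`; lane `lit-hodgefound`
(Track 2 foundations library), seat p11, generation 17, row g17-#3.  THEOREMS ONLY (no definition, no named fact;
D-0026, net debt 0).  Sequel, BY NAME (nothing restated), of

* `ComplexTorusEndomorphismSubfieldCenterMultiplicities.lean` (g16-#5), which proved the GALOIS CLAUSE of Thm. 2.3
  (`exists_algEquiv_ne_one_forall_finrank_eq`, `n_σ = n_{σκ}` for `κ ∈ Gal(E/𝒞_X)`, by Skolem–Noether) and whose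
  docstring prints «NOT HERE: the first assertion of Thm. 2.3 in full (for `E/𝒞_Z` not normal it says more:
  `n_σ` depends only on `σ|_{𝒞_Z}`)» — supplied here, by the printed proof;
* `ComplexTorusEndomorphismFieldEigenspaces.lean` (p13: the multiplicities `n_σ`, Remark 2.1 `n_σ + n_σ' = d`,
  `finrank_iInf_eigenspace_toLin'_map_mul_finrank` `dim V_σ · [E:ℚ] = 2 dim X`);
* `ComplexTorusHodgeLieAlgebraCommutant.lean` / `…Commutative.lean` / `…HodgeGroupLieAlgebraCartan.lean` (the Lie
  algebra `𝔥𝔤_ℝ = hodgeGroupLie Φ` of the Hodge group: `J ∈ 𝔥𝔤_ℝ`, `𝔥𝔤_ℝ` commutes with `End⁰(X) ⊗ ℝ`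
  (`map_ratCast_comm_of_mem_endAlgRat`), **its centre lies in `𝒞_X ⊗ ℝ`**
  (`mem_span_center_endAlgRat_of_forall_hodgeGroupLie_comm`), and for a polarisation the adjoint `X^† = -JXJ⁻¹`
  stays in `𝔥𝔤_ℝ` with `tr(X X^†) > 0`);
* `Literature/Algebra/Lie/TraceSeparatingCenterDerived.lean` (`𝔤 = 𝔷(𝔤) ⊕ [𝔤, 𝔤]` for a linear Lie algebra with
  non-degenerate trace form, anisotropic on the centre: `TraceSeparating.exists_central_add_derived`);
* `ComplexTorusHodgeGroupBorelEmbedding.lean` (`hodgeFiltrationConj J = V^{-1,0} = ker(J ⊗ 1 - i) ⊆ V_ℂ`).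

## Source, verbatim

Yu. G. Zarhin, *The endomorphism rings of jacobians of cyclic covers of the projective line*, Math. Proc. Cambridge
Philos. Soc. 136 (2004) 257–267 (held text `paper:arxiv-math_0103203`), §2:

* p0004: «Suppose `E` is a subfield of `End⁰(Z)` that contains the identity map. Then `H₁(Z,ℚ)` becomes an
  `E`-vector space of dimension `d = 2dim(Z)/[E:ℚ]`. We write `Tr_E : End_E(H₁(Z,ℚ)) → E` for the corresponding
  trace map […] `H₁(Z,ℚ) ⊗_ℚ ℂ = H₁(Z,ℂ)` […] `E_ℂ = E ⊗_ℚ ℂ = ∏_{σ ∈ Σ_E} ℂ_σ` […] the corresponding trace map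
  `Tr_{E_ℂ} : End_{E_ℂ}(H₁(Z,ℂ)) → E_ℂ` which coincides on `E_ℂ` with multiplication by `d` and with `Tr_E` on
  `End_E(H₁(Z,ℚ))`. […] `Lie(Z)_σ = ℂ_σ Lie(Z) = {x ∈ Lie(Z) ∣ ex = σ(e)x ∀ e ∈ E}`. Let us put
  `n_σ = n_σ(Z,E) = dim_{ℂ_σ} Lie(Z)_σ = dim_ℂ Lie(Z)_σ`. […] **Remark 2.1.** It is well-known ([Deligne], [MZ])
  that `n_σ + n_{σ'} = d ∀ σ ∈ Σ_E`. […] **Theorem 2.3.** Suppose `E` contains `𝒞_Z`. Then the tuple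
  `(n_σ)_{σ ∈ Σ_E} ∈ ∏_{σ ∈ Σ_E} ℂ_σ = E ⊗_ℚ ℂ` lies in `𝒞_Z ⊗_ℚ ℂ`. In particular, if `E/ℚ` is Galois and
  `𝒞_Z ≠ E` then there exists a nontrivial automorphism `κ : E → E` such that `n_σ = n_{σκ}` for all `σ ∈ Σ_E`.
  *Proof.* The inclusion `𝒞_Z ⊂ E` implies that `𝒞_Z` is a field. There is a canonical Hodge decomposition
  ([MumfordAV], [Deligne]) `H₁(Z,ℂ) = H^{-1,0} ⊕ H^{0,-1}` where `H^{-1,0}` and `H^{0,-1}` are mutually "complex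
  conjugate" `dim(Z)`-dimensional complex vector spaces. This splitting is `End⁰(Z)`-invariant and the
  `End⁰(Z)`-module `H^{-1,0}` is canonically isomorphic to `Lie(Z)`. Let `f_H : H₁(Z,ℂ) → H₁(Z,ℂ)` be the
  `ℂ`-linear operator in `H₁(Z,ℂ)` defined as follows. `f_H(x) = -x ∀ x ∈ H^{-1,0}`; `f_H(x) = 0 ∀ x ∈ H^{0,-1}`.
  Clearly, `f_H` commutes with `End⁰(Z)` and therefore with `E`. Hence `f_H` may be viewed as an endomorphism of
  the free `E_ℂ`-module `H₁(Z,ℂ)`; clearly, its trace is the tuple `(-n_σ)_{σ ∈ Σ_E} ∈ ∏_{σ∈Σ_E} ℂ_σ = E_ℂ`.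
  Suppose `MT = MT_Z ⊂ GL_ℚ(H₁(Z,ℚ))` is the Mumford-Tate group […] Let `mt ⊂ End_ℚ(H₁(Z,ℚ))` be the `ℚ`-Lie
  algebra of `MT`; it is a reductive algebraic linear `ℚ`-Lie algebra which contains scalars […] its
  complexification `mt_ℂ = mt ⊗_ℚ ℂ ⊂ End_ℂ(H₁(Z,ℂ))` contains scalars and `f_H`. It is well-known that the
  centralizer of `MT` (and therefore of `mt`) in `End_ℚ(H₁(Z,ℚ))` coincides with `End⁰(Z)`. This implies that
  the center `𝔠` of `mt` lies in `𝒞_Z`. Since `mt` is reductive, it splits into a direct sum `mt = mt^{ss} ⊕ 𝔠`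
  of `𝔠` and a semisimple `ℚ`-Lie algebra `mt^{ss}`. Clearly, `mt` lies in `End_E(H₁(Z,ℚ))`. Since `mt^{ss}` is
  semisimple and the trace map `Tr_E` is a Lie algebra homomorphism, `Tr_E(mt^{ss}) = {0}`. Since
  `𝔠 ⊂ 𝒞_Z ⊂ E`, we have `Tr_E(𝔠) ⊂ 𝒞_Z` and therefore `Tr_E(mt) ⊂ 𝒞_Z`. This implies easily that»
* p0005: «`Tr_{E_ℂ}(mt_ℂ) ⊂ 𝒞_Z ⊗_ℚ ℂ`. In particular, since `f_H ∈ mt_ℂ`, we have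
  `Tr_{E_ℂ}(f_H) ∈ 𝒞_Z ⊗_ℚ ℂ`. But `Tr_{E_ℂ}(f_H) = (-n_σ)_{σ ∈ Σ}`. This implies easily that
  `(n_σ)_{σ ∈ Σ_E} = -Tr_{E_ℂ}(f_H) ∈ 𝒞_Z ⊗_ℚ ℂ`.»

## Statement formalised (torus level) and the proof, step by step

`(X = E/Φ(ℤ^ι), η)` a polarised complex torus (`IsRiemannForm Φ η`; `|ι| = 2 dim X`), `K` a number field with
`f : K →ₐ[ℚ] M_ι(ℚ)` into `End⁰(X) = endAlgRat Φ` (p13's convention; `E := f(K)`), the multiplicity of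
`σ : K →+* ℂ` being p13's `n_σ = dim_ℂ ⨅_y ker(ρ_a(f y) - σ(y))` on `T₀X = E`, and the hypothesis
**"`E ⊇ 𝒞_Z`"**: `hcen : ∀ B ∈ endAlgRat Φ, (∀ C ∈ endAlgRat Φ, B C = C B) → B ∈ Set.range f` (as in g16-#5).
Since `𝒞_Z ⊗_ℚ ℂ ⊆ E ⊗_ℚ ℂ = ∏_σ ℂ_σ` is the set of tuples `(u_σ)` with `u_σ = u_τ` whenever
`σ|_{𝒞_Z} = τ|_{𝒞_Z}` (`𝒞_Z` a subfield of `E`), the first assertion of Theorem 2.3 reads: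

* **`IsRiemannForm.finrank_iInf_eigenspace_analyticRepHom_eq_of_center_subset`** — if `σ, τ : K →+* ℂ` agree on
  every `k` with `f k` central (`hστ`), then `n_σ = n_τ`.

Proof as printed, with ONE substitution, recorded: the reductive `ℚ`-Lie algebra `mt ∋ f_H` (after `⊗ ℂ`) of the
Mumford–Tate group is replaced by the tree's real Lie algebra `𝔥𝔤_ℝ = hodgeGroupLie Φ` of the Hodge group,
which contains `J = h'(i)` (`jMatrix_mem_hodgeGroupLie`) and hence, after `⊗ ℂ`, Zarhin's
`f_H = (i (J ⊗ 1) - 1)/2`; every printed step has its counterpart: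
* §1 "`H^{-1,0}` is canonically isomorphic to `Lie(Z)`" compatibly with `End⁰(Z)`:
  `exists_linearMap_range_eq_hodgeFiltrationConj` (`ψ(Φ x) = x ⊗ 1 - i (Jx) ⊗ 1`, image `V^{-1,0}`, intertwining
  `ρ_a(A)` with `A ⊗ 1`), so `n_σ = dim_ℂ (V_σ ∩ V^{-1,0})` (`finrank_iInf_eigenspace_analyticRepHom_eq_finrank_inf`,
  `V_σ ⊆ V_ℂ` the simultaneous eigenspace of `E ⊗ 1`);
* §2 "its trace is the tuple `(-n_σ)`": `tr(J ⊗ 1 | V_σ) = i (2 n_σ - dim V_σ)` (`trace_restrict_toLin'_jMatrix`, via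
  the projector `(1 - i(J ⊗ 1))/2 = -f_H` of `V_σ` onto `V_σ ∩ V^{-1,0}`; `trace_restrict_toLin'_jMatrix_iInf_eigenspace`);
* §3 the `σ`-component of `Tr_{E_ℂ}`, as the functional `X ↦ tr((X ⊗ 1) ∘ p_σ)` for a projector `p_σ` onto `V_σ`:
  it is `tr(X|_{V_σ})` on operators preserving `V_σ` (`trace_mul_eq_trace_restrict_of_isProj`), kills their
  commutators ("`Tr_E` is a Lie algebra homomorphism", `trace_commutator_mul_eq_zero_of_isProj`) and is `σ(k) d` on
  `f(k) ⊗ 1` ("coincides on `E_ℂ` with multiplication by `d`", `trace_mul_eq_mul_finrank_of_isProj`);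
* §4 "since `mt` is reductive, it splits `mt = mt^{ss} ⊕ 𝔠`", applied to `f_H`: `J = Z + D` with `Z` central in
  `𝔥𝔤_ℝ` and `D ∈ [𝔥𝔤_ℝ, 𝔥𝔤_ℝ]` (`IsRiemannForm.exists_central_add_mem_span_commutator_eq_jMatrix`, from
  `TraceSeparating.exists_central_add_derived`: the trace form of `𝔥𝔤_ℝ ⊆ End(V_ℝ)` is non-degenerate, `tr(XX^†) > 0`,
  and anisotropic on the centre, `Z^† = -Z` for `Z` central since `Z` commutes with `J`);
* §5 "the center `𝔠` of `mt` lies in `𝒞_Z`" is the tree's `mem_span_center_endAlgRat_of_forall_hodgeGroupLie_comm`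
  (`Z ∈ 𝒞_X ⊗ ℝ`); "`Tr_E(mt^{ss}) = 0`" is §3 on `D`; "`Tr_E(𝔠) ⊂ 𝒞_Z`" becomes: on `𝒞_X ⊗ ℝ ⊆ f(K) ⊗ ℝ` the
  functionals for `σ` and `τ` agree (`σ(k) d = τ(k) d` for `f k` central, `hστ`); hence
  `i(2n_σ - d) = tr(J ⊗ 1|V_σ) = Λ_σ(Z) = Λ_τ(Z) = tr(J ⊗ 1|V_τ) = i(2n_τ - d)`.

Consequences (proved): `IsRiemannForm.two_mul_finrank_iInf_eigenspace_analyticRepHom_mul_finrank_of_center_subset`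
(`2 n_σ [E:ℚ] = 2 dim X` as soon as `σ̄ = σ` on `f⁻¹(𝒞_X)` — Thm. 2.3 + Rem. 2.1; the way the theorem is used for a
totally real centre, "the pair is of Weil type", Zarhin 2002 Thm. 3.8 (i)) and
`IsRiemannForm.two_mul_finrank_iInf_eigenspace_analyticRepHom_mul_finrank_of_center_eq_bot` (`𝒞_X = ℚ`).

NOT HERE: the Galois clause (in the tree, g16-#5, not re-derived); the Mumford–Tate group / `mt` over `ℚ` itself
(the tree's `𝔥𝔤_ℝ` is used instead, see above); `Tr_{E_ℂ}` as an `E_ℂ`-valued trace (only its `σ`-components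
`Λ_σ` appear).

## References

* [Zarhin2004EndomorphismRingsCyclicCovers] Yu. G. Zarhin, The endomorphism rings of jacobians of cyclic covers of
  the projective line, Math. Proc. Cambridge Philos. Soc. 136 (2004) 257–267, §2 Thm. 2.3, Rem. 2.1 and proof
  (arXiv math/0103203, p0004–p0005).
* [Zarhin2002CyclicCovers] Yu. G. Zarhin, Cyclic covers of the projective line, their jacobians and endomorphisms,
  J. reine angew. Math. 544 (2002), §3 Thm. 3.8 (i).
* [MoonenZarhin1998WeilClasses] B. Moonen, Yu. G. Zarhin, Weil classes on abelian varieties, J. reine angew. Math.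
  496 (1998), (3), (5).
* [Lange2023AbelianVarietiesComplex] H. Lange, Abelian Varieties over the Complex Numbers (2023), §1.1.2 Prop. 1.2.3,
  §7.2.4 Exercises (2), (3).
-/

noncomputable section

open Module NumberField Matrix

namespace Literature.Geometry.Kaehler

namespace ComplexTorus

variable {ι : Type*} [Fintype ι] [DecidableEq ι] {E : Type*} [NormedAddCommGroup E] [NormedSpace ℂ E]
  (Φ : (ι → ℝ) ≃L[ℝ] E)

/-! ## §1 `T₀X ≅ V^{-1,0} ⊂ V_ℂ`: the multiplicities `n_σ` read on `H₁(X, ℂ)` -/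

omit [DecidableEq ι] in
/-- Complexification of a real vector commutes with a real matrix: `(A ⊗ 1)(x ⊗ 1) = (A x) ⊗ 1`. [folklore] -/
private theorem map_ofRealHom_mulVec_ofReal (A : Matrix ι ι ℝ) (x : ι → ℝ) :
    A.map Complex.ofRealHom *ᵥ (fun i ↦ (x i : ℂ)) = fun i ↦ ((A *ᵥ x) i : ℂ) := by
  funext i
  have h := RingHom.map_mulVec Complex.ofRealHom A x i
  rw [Complex.ofRealHom_eq_coe] at h
  rw [h]
  rfl

/-- **`T₀X ≅ V^{-1,0}` compatibly with `End_ℚ(X) ⊗ ℝ`.** The `ℂ`-linear map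
`ψ : T₀X = E → V_ℂ = ℂ^ι`, `ψ(Φ x) = x ⊗ 1 - i (Jx) ⊗ 1`, is injective with image `V^{-1,0} = ker(J ⊗ 1 - i)`,
and intertwines the analytic representation `ρ_a(A)` of a real `A` commuting with `J` with `A ⊗ 1`
("the `End⁰(Z)`-module `H^{-1,0}` is canonically isomorphic to `Lie(Z)`").
[cite: Zarhin2004EndomorphismRingsCyclicCovers, §2 proof of Thm. 2.3 (p0004: "`H^{-1,0}` is canonically isomorphic to `Lie(Z)`")]
[cite: Lange2023AbelianVarietiesComplex, §1.1.2 Prop. 1.2.3 (`ρ_r ⊗ 1 ≅ ρ_a ⊕ ρ̄_a`)] -/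
theorem exists_linearMap_range_eq_hodgeFiltrationConj :
    ∃ ψ : E →ₗ[ℂ] (ι → ℂ), Function.Injective ψ ∧
      (∀ v, ψ v ∈ hodgeFiltrationConj (jMatrix Φ)) ∧
      (∀ w ∈ hodgeFiltrationConj (jMatrix Φ), ∃ v, ψ v = w) ∧
      ∀ (A : Matrix ι ι ℝ) (hA : A * jMatrix Φ = jMatrix Φ * A) (v : E),
        ψ (analyticRep Φ Φ A hA v) = Matrix.toLin' (A.map Complex.ofRealHom) (ψ v) := by
  classical
  set J := jMatrix Φ with hJdef
  have hJJ : J * J = -1 := jMatrix_mul_jMatrix Φ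
  -- complexification of real vectors
  let c : (ι → ℝ) →ₗ[ℝ] (ι → ℂ) := Complex.ofRealAm.toLinearMap.compLeft ι
  have hc : ∀ x : ι → ℝ, c x = fun i ↦ (x i : ℂ) := fun x ↦ rfl
  have hcJ : ∀ x : ι → ℝ, J.map Complex.ofRealHom *ᵥ c x = c (J *ᵥ x) := fun x ↦ by
    rw [hc, hc, map_ofRealHom_mulVec_ofReal]
  -- the real-linear map `ψ₀ v = c x - i (J ⊗ 1) c x`, `x = Φ⁻¹ v`
  let ψ₀ : E →ₗ[ℝ] (ι → ℂ) :=
    ((LinearMap.id - Complex.I • Matrix.toLin' (J.map Complex.ofRealHom)).restrictScalars ℝ) ∘ₗ c ∘ₗ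
      (Φ.symm : E →L[ℝ] (ι → ℝ)).toLinearMap
  have hψ₀ : ∀ v, ψ₀ v = c (Φ.symm v) - Complex.I • (J.map Complex.ofRealHom *ᵥ c (Φ.symm v)) := fun v ↦ by
    simp only [ψ₀, LinearMap.coe_comp, Function.comp_apply, LinearMap.coe_restrictScalars, LinearMap.sub_apply,
      LinearMap.id_apply, LinearMap.smul_apply, Matrix.toLin'_apply]
    rfl
  have hsymmI : ∀ v, Φ.symm (Complex.I • v) = J *ᵥ Φ.symm v := fun v ↦ by
    rw [hJdef, jMatrix_mulVec, latticeJ_apply, ContinuousLinearEquiv.apply_symm_apply]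
  have hψ₀I : ∀ v, ψ₀ (Complex.I • v) = Complex.I • ψ₀ v := fun v ↦ by
    rw [hψ₀, hψ₀, hsymmI, hcJ, hcJ, Matrix.mulVec_mulVec, hJJ, Matrix.neg_mulVec, Matrix.one_mulVec, map_neg]
    simp only [smul_sub, smul_neg, smul_smul, Complex.I_mul_I, neg_smul, one_smul, sub_neg_eq_add]
    abel
  -- `ψ₀` is `ℂ`-linear
  let ψ : E →ₗ[ℂ] (ι → ℂ) :=
    { toFun := ψ₀
      map_add' := ψ₀.map_add
      map_smul' := fun z v ↦ by
        have hz : z • v = (z.re : ℝ) • v + (z.im : ℝ) • (Complex.I • v) := by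
          conv_lhs => rw [← Complex.re_add_im z]
          rw [add_smul, mul_smul, Complex.coe_smul, Complex.coe_smul]
        have hz' : z • ψ₀ v = (z.re : ℝ) • ψ₀ v + (z.im : ℝ) • (Complex.I • ψ₀ v) := by
          conv_lhs => rw [← Complex.re_add_im z]
          rw [add_smul, mul_smul, Complex.coe_smul, Complex.coe_smul]
        rw [RingHom.id_apply, hz, hz', map_add, ψ₀.map_smul, ψ₀.map_smul, hψ₀I] }
  have hψ : ∀ v, ψ v = c (Φ.symm v) - Complex.I • (J.map Complex.ofRealHom *ᵥ c (Φ.symm v)) := hψ₀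
  refine ⟨ψ, ?_, fun v ↦ ?_, fun w hw ↦ ?_, fun A hA v ↦ ?_⟩
  · -- injective: the real parts of `ψ(Φ x)` are the `x i`
    intro v v' hvv'
    have hx : Φ.symm v = Φ.symm v' := by
      funext i
      have h1 := congrFun hvv' i
      rw [hψ, hψ, hcJ, hcJ] at h1
      have h2 := congrArg Complex.re h1
      simpa [hc] using h2
    simpa using congrArg Φ hx
  · -- image inside `V^{-1,0}`
    rw [hψ]
    exact sub_I_smul_mulVec_mem_hodgeFiltrationConj hJJ _
  · -- onto `V^{-1,0}`: `w = a ⊗ 1 + i b ⊗ 1` with `J a = -b`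
    let a : ι → ℝ := fun i ↦ (w i).re
    let b : ι → ℝ := fun i ↦ (w i).im
    have hw' := (mem_hodgeFiltrationConj_iff.1 hw)
    have hJa : J *ᵥ a = -b := by
      funext i
      have h1 := congrArg Complex.re (congrFun hw' i)
      simp only [Matrix.mulVec, dotProduct, Matrix.map_apply, Complex.ofRealHom_eq_coe, Complex.re_sum,
        Pi.smul_apply, smul_eq_mul, Complex.mul_re, Complex.I_re, zero_mul,
        Complex.I_im, one_mul, zero_sub] at h1
      simpa [a, b, Matrix.mulVec, dotProduct] using h1
    refine ⟨Φ a, ?_⟩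
    rw [hψ, ContinuousLinearEquiv.symm_apply_apply, hcJ, hJa, map_neg, smul_neg, sub_neg_eq_add]
    funext i
    simp only [hc, Pi.add_apply, Pi.smul_apply, smul_eq_mul, a, b]
    rw [mul_comm]
    exact Complex.re_add_im (w i)
  · -- intertwining with `ρ_a(A) = Φ ∘ A ∘ Φ⁻¹`
    have hAc : A.map Complex.ofRealHom * J.map Complex.ofRealHom = J.map Complex.ofRealHom * A.map Complex.ofRealHom := by
      rw [← Matrix.map_mul, hA, Matrix.map_mul]
    have hcA : ∀ x : ι → ℝ, c (A *ᵥ x) = A.map Complex.ofRealHom *ᵥ c x := fun x ↦ by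
      rw [hc, hc, map_ofRealHom_mulVec_ofReal]
    rw [hψ, hψ, analyticRep_apply', ContinuousLinearEquiv.symm_apply_apply, hcA, Matrix.toLin'_apply,
      Matrix.mulVec_sub, Matrix.mulVec_smul, Matrix.mulVec_mulVec, Matrix.mulVec_mulVec, hAc]


/-! ## §2 A number field `f : K → End_ℚ(X)`: `n_σ = dim_ℂ (V_σ ∩ V^{-1,0})`, and `tr(J ⊗ 1 | V_σ) = i(2 n_σ - d)` -/

section Multiplicities

variable {K : Type*} [Field K] [NumberField K] (f : K →ₐ[ℚ] Matrix ι ι ℚ) (hf : ∀ x, f x ∈ endAlgRat Φ)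

omit [Fintype ι] [DecidableEq ι] in
/-- `((A ⊗_ℚ ℝ) ⊗_ℝ ℂ) = A ⊗_ℚ ℂ` for a rational matrix. [folklore] -/
private theorem map_ratCast_map_ofRealHom (A : Matrix ι ι ℚ) :
    (A.map ((↑) : ℚ → ℝ)).map Complex.ofRealHom = A.map (algebraMap ℚ ℂ) := by
  ext i j
  simp [Matrix.map_apply]

include hf in
/-- **`n_σ = dim_ℂ V^{-1,0}_{ℂ,σ}`**: the multiplicity of `σ` on the tangent space (the tree's
`n_σ = dim_ℂ {v ∈ T₀X | ρ_a(f y) v = σ(y) v ∀ y}`) is the dimension of the part of the simultaneous eigenspace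
`V_σ = {v ∈ V_ℂ | (f y ⊗ 1) v = σ(y) v}` of `V_ℂ = H₁(X, ℂ)` lying in `V^{-1,0} = H^{-1,0}` ("The dimension `n_σ`
of `V^{1,0}_{ℂ,σ}` is called the multiplicity of `σ`"; "`H^{-1,0}` is canonically isomorphic to `Lie(Z)`").
[cite: Zarhin2004EndomorphismRingsCyclicCovers, §2 (p0004: `Lie(Z)_σ`, `n_σ`; proof of Thm. 2.3)]
[cite: MoonenZarhin1998WeilClasses, §3 (3)] -/
theorem finrank_iInf_eigenspace_analyticRepHom_eq_finrank_inf (σ : K →+* ℂ) :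
    finrank ℂ ↥(⨅ y : K, Module.End.eigenspace
        ((analyticRepHom Φ ⟨f y, hf y⟩ : E →L[ℂ] E) : E →ₗ[ℂ] E) (σ y)) =
      finrank ℂ ↥((⨅ y : K, Module.End.eigenspace (Matrix.toLin' ((f y).map (algebraMap ℚ ℂ))) (σ y)) ⊓
        hodgeFiltrationConj (jMatrix Φ)) := by
  obtain ⟨ψ, hinj, hmem, hsurj, hψ⟩ := exists_linearMap_range_eq_hodgeFiltrationConj Φ
  have hρ : ∀ (y : K) (v : E), ψ (analyticRepHom Φ ⟨f y, hf y⟩ v) =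
      Matrix.toLin' ((f y).map (algebraMap ℚ ℂ)) (ψ v) := fun y v ↦ by
    rw [analyticRepHom_apply, hψ, map_ratCast_map_ofRealHom]
  set T := ⨅ y : K, Module.End.eigenspace ((analyticRepHom Φ ⟨f y, hf y⟩ : E →L[ℂ] E) : E →ₗ[ℂ] E) (σ y)
    with hT
  have hmap : Submodule.map ψ T =
      (⨅ y : K, Module.End.eigenspace (Matrix.toLin' ((f y).map (algebraMap ℚ ℂ))) (σ y)) ⊓
        hodgeFiltrationConj (jMatrix Φ) := by
    apply le_antisymm
    · rintro _ ⟨v, hv, rfl⟩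
      refine Submodule.mem_inf.2 ⟨(Submodule.mem_iInf _).2 fun y ↦ ?_, hmem v⟩
      have h1 := Module.End.mem_eigenspace_iff.1 ((Submodule.mem_iInf _).1 hv y)
      rw [ContinuousLinearMap.coe_coe] at h1
      rw [Module.End.mem_eigenspace_iff, ← hρ, h1, map_smul]
    · intro w hw
      obtain ⟨hw1, hw2⟩ := Submodule.mem_inf.1 hw
      obtain ⟨v, rfl⟩ := hsurj w hw2
      refine ⟨v, (Submodule.mem_iInf _).2 fun y ↦ ?_, rfl⟩
      rw [Module.End.mem_eigenspace_iff, ContinuousLinearMap.coe_coe]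
      apply hinj
      rw [hρ, map_smul]
      exact Module.End.mem_eigenspace_iff.1 ((Submodule.mem_iInf _).1 hw1 y)
  rw [← hmap]
  exact (Submodule.equivMapOfInjective ψ hinj T).finrank_eq

omit [DecidableEq ι] in
/-- **`tr(J ⊗ 1 | W) = i (2 dim(W ∩ V^{-1,0}) - dim W)`** for a `(J ⊗ 1)`-stable subspace `W ⊆ V_ℂ`: on `W` the
operator `J ⊗ 1` has the eigenvalues `i` on `W ∩ V^{-1,0}` and `-i` on `W ∩ V^{0,-1}` (Zarhin's `f_H = (i(J⊗1) - 1)/2`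
is `-1` on `H^{-1,0}` and `0` on `H^{0,-1}`, "its trace is the tuple `(-n_σ)`").
[cite: Zarhin2004EndomorphismRingsCyclicCovers, §2 proof of Thm. 2.3 (p0004: "`f_H(x) = -x ∀ x ∈ H^{-1,0}`; `f_H(x) = 0 ∀ x ∈ H^{0,-1}`")] -/
theorem trace_restrict_toLin'_jMatrix [DecidableEq ι] (W : Submodule ℂ (ι → ℂ))
    (hW : ∀ v ∈ W, Matrix.toLin' ((jMatrix Φ).map Complex.ofRealHom) v ∈ W) :
    LinearMap.trace ℂ W ((Matrix.toLin' ((jMatrix Φ).map Complex.ofRealHom)).restrict hW) =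
      Complex.I * (2 * (finrank ℂ ↥(W ⊓ hodgeFiltrationConj (jMatrix Φ)) : ℂ) - (finrank ℂ W : ℂ)) := by
  set T : W →ₗ[ℂ] W := (Matrix.toLin' ((jMatrix Φ).map Complex.ofRealHom)).restrict hW with hTdef
  have hT : ∀ w : W, ((T w : W) : ι → ℂ) = (jMatrix Φ).map Complex.ofRealHom *ᵥ (w : ι → ℂ) := fun w ↦ rfl
  have hTT : ∀ w : W, T (T w) = -w := fun w ↦ Subtype.ext (by
    rw [hT, hT, map_ofRealHom_mulVec_mulVec_of_mul_self (jMatrix_mul_jMatrix Φ), Submodule.coe_neg])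
  -- the projector `p = (1 - i T)/2` onto `W ∩ V^{-1,0}` along `W ∩ V^{0,-1}`
  set p : W →ₗ[ℂ] W := (2 : ℂ)⁻¹ • (LinearMap.id - Complex.I • T) with hpdef
  have hp : ∀ w, p w = (2 : ℂ)⁻¹ • (w - Complex.I • T w) := fun w ↦ rfl
  have hTp : ∀ w, T (p w) = Complex.I • p w := fun w ↦ by
    rw [hp, map_smul, map_sub, map_smul, hTT, smul_comm Complex.I (2 : ℂ)⁻¹]
    congr 1
    rw [smul_sub, smul_smul, Complex.I_mul_I, neg_smul, one_smul, smul_neg]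
    abel
  have hpidem : IsIdempotentElem p := by
    refine LinearMap.ext fun w ↦ ?_
    rw [Module.End.mul_apply, hp (p w), hTp, smul_smul, Complex.I_mul_I, neg_smul, one_smul, sub_neg_eq_add,
      ← two_smul ℂ (p w), smul_smul, inv_mul_cancel₀ two_ne_zero, one_smul]
  -- its range is `W ∩ V^{-1,0}` (seen inside `W`)
  have hrange : LinearMap.range p = Submodule.comap W.subtype (hodgeFiltrationConj (jMatrix Φ)) := by
    apply le_antisymm
    · rintro _ ⟨w, rfl⟩
      rw [Submodule.mem_comap, Submodule.subtype_apply, mem_hodgeFiltrationConj_iff, ← hT, hTp, Submodule.coe_smul]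
    · intro w hw
      rw [Submodule.mem_comap, Submodule.subtype_apply, mem_hodgeFiltrationConj_iff, ← hT] at hw
      have hTw : T w = Complex.I • w := Subtype.ext (by rw [hw, Submodule.coe_smul])
      refine ⟨w, ?_⟩
      rw [hp, hTw, smul_smul, Complex.I_mul_I, neg_smul, one_smul, sub_neg_eq_add, ← two_smul ℂ w, smul_smul,
        inv_mul_cancel₀ two_ne_zero, one_smul]
  have hfin : finrank ℂ ↥(LinearMap.range p) = finrank ℂ ↥(W ⊓ hodgeFiltrationConj (jMatrix Φ)) := by
    rw [hrange, ← Submodule.finrank_map_subtype_eq W, Submodule.map_comap_subtype]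
  -- traces: `tr p = dim(W ∩ V^{-1,0})`, `T = i (2p - 1)`
  haveI : Module.Free ℂ ↥(LinearMap.range p) := Module.Free.of_divisionRing ℂ ↥(LinearMap.range p)
  haveI : Module.Free ℂ ↥(LinearMap.ker p) := Module.Free.of_divisionRing ℂ ↥(LinearMap.ker p)
  have htrp : LinearMap.trace ℂ W p = (finrank ℂ ↥(W ⊓ hodgeFiltrationConj (jMatrix Φ)) : ℂ) := by
    rw [(LinearMap.IsIdempotentElem.isProj_range p hpidem).trace, hfin]
  have hTp' : T = Complex.I • ((2 : ℂ) • p - LinearMap.id) := LinearMap.ext fun w ↦ by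
    rw [LinearMap.smul_apply, LinearMap.sub_apply, LinearMap.smul_apply, LinearMap.id_apply, hp, smul_smul,
      mul_inv_cancel₀ two_ne_zero, one_smul, sub_sub_cancel_left, smul_neg, smul_smul, Complex.I_mul_I, neg_smul,
      one_smul, neg_neg]
  -- (`map_sub`/`map_smul` do not fire by pattern on `LinearMap.trace ℂ ↥W`; instantiate them first)
  have h1 := (LinearMap.trace ℂ W).map_smul Complex.I ((2 : ℂ) • p - LinearMap.id)
  have h2 := (LinearMap.trace ℂ W).map_sub ((2 : ℂ) • p) LinearMap.id
  have h3 := (LinearMap.trace ℂ W).map_smul (2 : ℂ) p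
  rw [hTp', h1, h2, h3, htrp, LinearMap.trace_id, smul_eq_mul, smul_eq_mul]

/-- A real matrix commuting with all `(f y) ⊗_ℚ ℝ` preserves every simultaneous eigenspace `V_σ ⊆ V_ℂ` of `f(K)`.
[cite: Zarhin2004EndomorphismRingsCyclicCovers, §2 proof of Thm. 2.3 (p0005: "`mt` lies in `End_E(H_1(Z,ℚ))`")] -/
theorem toLin'_map_mem_iInf_eigenspace_of_comm {X : Matrix ι ι ℝ}
    (hX : ∀ y : K, (f y).map ((↑) : ℚ → ℝ) * X = X * (f y).map ((↑) : ℚ → ℝ)) (σ : K →+* ℂ) :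
    ∀ v ∈ (⨅ y : K, Module.End.eigenspace (Matrix.toLin' ((f y).map (algebraMap ℚ ℂ))) (σ y)),
      Matrix.toLin' (X.map Complex.ofRealHom) v ∈
        (⨅ y : K, Module.End.eigenspace (Matrix.toLin' ((f y).map (algebraMap ℚ ℂ))) (σ y)) := by
  intro v hv
  rw [Submodule.mem_iInf] at hv ⊢
  intro y
  have hy := Module.End.mem_eigenspace_iff.1 (hv y)
  rw [Matrix.toLin'_apply] at hy
  rw [Module.End.mem_eigenspace_iff, Matrix.toLin'_apply, Matrix.toLin'_apply, Matrix.mulVec_mulVec,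
    ← map_ratCast_map_ofRealHom, ← Matrix.map_mul, hX y, Matrix.map_mul, ← Matrix.mulVec_mulVec,
    map_ratCast_map_ofRealHom, hy, Matrix.mulVec_smul]

include hf in
/-- **`tr(J ⊗ 1 | V_σ) = i (2 n_σ - d)`**, `d = dim_ℂ V_σ = 2 dim X/[K:ℚ]`, for `f(K) ⊆ End_ℚ(X)` (so that `J`
commutes with `f(K) ⊗ ℝ` and preserves `V_σ`) — "`Tr_{E_ℂ}(f_H) = (-n_σ)_{σ ∈ Σ}`" with `f_H = (i (J ⊗ 1) - 1)/2`.
[cite: Zarhin2004EndomorphismRingsCyclicCovers, §2 proof of Thm. 2.3 (p0004–p0005)] -/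
theorem trace_restrict_toLin'_jMatrix_iInf_eigenspace (σ : K →+* ℂ)
    (hJ : ∀ v ∈ (⨅ y : K, Module.End.eigenspace (Matrix.toLin' ((f y).map (algebraMap ℚ ℂ))) (σ y)),
      Matrix.toLin' ((jMatrix Φ).map Complex.ofRealHom) v ∈
        (⨅ y : K, Module.End.eigenspace (Matrix.toLin' ((f y).map (algebraMap ℚ ℂ))) (σ y))) :
    LinearMap.trace ℂ _ ((Matrix.toLin' ((jMatrix Φ).map Complex.ofRealHom)).restrict hJ) =
      Complex.I * (2 * (finrank ℂ ↥(⨅ y : K, Module.End.eigenspace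
          ((analyticRepHom Φ ⟨f y, hf y⟩ : E →L[ℂ] E) : E →ₗ[ℂ] E) (σ y)) : ℂ) -
        (finrank ℂ ↥(⨅ y : K, Module.End.eigenspace (Matrix.toLin' ((f y).map (algebraMap ℚ ℂ))) (σ y)) : ℂ)) := by
  rw [trace_restrict_toLin'_jMatrix Φ _ hJ, finrank_iInf_eigenspace_analyticRepHom_eq_finrank_inf Φ f hf σ]

end Multiplicities

/-! ## §3 Traces against a projector: `tr(T ∘ p) = tr(T|_W)`, `tr([X, Y] ∘ p) = 0`, `tr(c ∘ p) = c dim W` -/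

section ProjectorTrace

variable {L : Type*} [Field L] {V : Type*} [AddCommGroup V] [Module L V] [FiniteDimensional L V]

/-- `tr(T ∘ p) = tr(T|_W)` for a projector `p` onto a `T`-stable subspace `W`. [folklore] -/
private theorem trace_mul_eq_trace_restrict_of_isProj {W : Submodule L V} {p : V →ₗ[L] V} (hp : LinearMap.IsProj W p)
    {T : V →ₗ[L] V} (hT : ∀ v ∈ W, T v ∈ W) :
    LinearMap.trace L V (T * p) = LinearMap.trace L W (T.restrict hT) := by
  have h1 : ∀ v, (T * p) v ∈ W := fun v ↦ hT _ (hp.map_mem v)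
  rw [← LinearMap.trace_restrict_eq_of_forall_mem W (T * p) h1]
  congr 1
  ext ⟨w, hw⟩
  rw [LinearMap.coe_restrict_apply, LinearMap.coe_restrict_apply, Module.End.mul_apply, hp.map_id w hw]

omit [FiniteDimensional L V] in
/-- `tr([X, Y] ∘ p) = 0` for a projector `p` onto a subspace stable under `X` and `Y` ("the trace map `Tr_E` is a
Lie algebra homomorphism"). [cite: Zarhin2004EndomorphismRingsCyclicCovers, §2 proof of Thm. 2.3 (p0004)] -/
theorem trace_commutator_mul_eq_zero_of_isProj {W : Submodule L V} {p : V →ₗ[L] V} (hp : LinearMap.IsProj W p)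
    {X Y : V →ₗ[L] V} (hX : ∀ v ∈ W, X v ∈ W) (hY : ∀ v ∈ W, Y v ∈ W) :
    LinearMap.trace L V ((X * Y - Y * X) * p) = 0 := by
  have key : ∀ {T : V →ₗ[L] V}, (∀ v ∈ W, T v ∈ W) → p * (T * p) = T * p := fun hT ↦
    LinearMap.ext fun v ↦ hp.map_id _ (hT _ (hp.map_mem v))
  have h1 : X * Y * p = (X * p) * (Y * p) := by rw [mul_assoc X p, key hY, mul_assoc]
  have h2 : Y * X * p = (Y * p) * (X * p) := by rw [mul_assoc Y p, key hX, mul_assoc]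
  rw [sub_mul, map_sub, h1, h2, LinearMap.trace_mul_comm, sub_self]

/-- `tr(T ∘ p) = c · dim W` for a projector `p` onto a subspace `W` on which `T` is the scalar `c` ("`Tr_{E_ℂ}` coincides
on `E_ℂ` with multiplication by `d`"). [cite: Zarhin2004EndomorphismRingsCyclicCovers, §2 (p0004)] -/
theorem trace_mul_eq_mul_finrank_of_isProj {W : Submodule L V} {p : V →ₗ[L] V} (hp : LinearMap.IsProj W p)
    {T : V →ₗ[L] V} {c : L} (hT : ∀ v ∈ W, T v = c • v) :
    LinearMap.trace L V (T * p) = c * (finrank L W : L) := by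
  have h1 : T * p = c • p := LinearMap.ext fun v ↦ by
    rw [Module.End.mul_apply, LinearMap.smul_apply, hT _ (hp.map_mem v)]
  haveI : Module.Free L ↥W := Module.Free.of_divisionRing L ↥W
  haveI : Module.Free L ↥(LinearMap.ker p) := Module.Free.of_divisionRing L ↥(LinearMap.ker p)
  rw [h1, map_smul, hp.trace, smul_eq_mul]

omit [FiniteDimensional L V] in
/-- Every subspace is the image of a projector. [folklore] -/
private theorem exists_isProj (W : Submodule L V) : ∃ p : V →ₗ[L] V, LinearMap.IsProj W p := by
  obtain ⟨Q, hQ⟩ := W.exists_isCompl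
  exact ⟨W.projection Q hQ, ⟨Submodule.projection_apply_mem hQ, fun x hx ↦ Submodule.projection_apply_of_mem_left hQ hx⟩⟩

end ProjectorTrace

/-! ## §4 `𝔥𝔤_ℝ = 𝔷(𝔥𝔤_ℝ) ⊕ [𝔥𝔤_ℝ, 𝔥𝔤_ℝ]` applied to `J`: `J = Z + D` -/

section Reductive

variable {Φ}

/-- **`J = Z + D` with `Z` central in `𝔥𝔤_ℝ` and `D ∈ [𝔥𝔤_ℝ, 𝔥𝔤_ℝ]`** (polarised torus). The Lie algebra `𝔥𝔤_ℝ` of the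
Hodge group is reductive, `𝔥𝔤_ℝ = 𝔷(𝔥𝔤_ℝ) ⊕ [𝔥𝔤_ℝ, 𝔥𝔤_ℝ]`: its trace form is non-degenerate (`tr(X X^†) > 0` for
`X ≠ 0`, and `X^† = -JXJ⁻¹ ∈ 𝔥𝔤_ℝ`) and anisotropic on the centre (a central `Z` commutes with `J ∈ 𝔥𝔤_ℝ`, so
`Z^† = -Z` and `tr(Z²) = -tr(Z Z^†) < 0` for `Z ≠ 0`), whence the splitting (the tree's
`TraceSeparating.exists_central_add_derived`); applied to `J = h'(i) ∈ 𝔥𝔤_ℝ` — Zarhin's "since `mt` is reductive, it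
splits into a direct sum `mt = mt^{ss} ⊕ 𝔠`", used for `f_H = (i (J ⊗ 1) - 1)/2 ∈ mt_ℂ`, here for the real Lie algebra
`𝔥𝔤_ℝ ∋ J` of the Hodge group. [cite: Zarhin2004EndomorphismRingsCyclicCovers, §2 proof of Thm. 2.3 (p0004)]
[cite: Lange2023AbelianVarietiesComplex, §7.2.4 Exercise (2)] -/
theorem IsRiemannForm.exists_central_add_mem_span_commutator_eq_jMatrix {η : E [⋀^Fin 2]→L[ℝ] ℝ}
    (hη : IsRiemannForm Φ η) :
    ∃ Z ∈ hodgeGroupLie Φ, (∀ Y ∈ hodgeGroupLie Φ, Z * Y = Y * Z) ∧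
      ∃ D ∈ Submodule.span ℝ {B : Matrix ι ι ℝ | ∃ X ∈ hodgeGroupLie Φ, ∃ Y ∈ hodgeGroupLie Φ, X * Y - Y * X = B},
        jMatrix Φ = Z + D := by
  letI : LieRing (Matrix ι ι ℝ) := LieRing.ofAssociativeRing
  set φ : Matrix ι ι ℝ ≃ₐ[ℝ] Module.End ℝ (ι → ℝ) := Matrix.toLinAlgEquiv' with hφ
  have htr : ∀ M : Matrix ι ι ℝ, LinearMap.trace ℝ (ι → ℝ) (φ M) = M.trace := fun M ↦ Matrix.trace_toLin'_eq M
  -- `𝔤 = 𝔥𝔤_ℝ` viewed inside `End(V_ℝ)`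
  obtain ⟨𝔤, h𝔤⟩ : ∃ 𝔤 : Submodule ℝ (Module.End ℝ (ι → ℝ)), ∀ A, A ∈ 𝔤 ↔ φ.symm A ∈ hodgeGroupLie Φ :=
    ⟨(hodgeGroupLie Φ).toSubmodule.comap (φ.symm.toLinearEquiv : Module.End ℝ (ι → ℝ) →ₗ[ℝ] Matrix ι ι ℝ),
      fun A ↦ Iff.rfl⟩
  have hmem : ∀ {A : Module.End ℝ (ι → ℝ)}, A ∈ 𝔤 ↔ φ.symm A ∈ hodgeGroupLie Φ := fun {A} ↦ h𝔤 A
  have hmem' : ∀ {M : Matrix ι ι ℝ}, φ M ∈ 𝔤 ↔ M ∈ hodgeGroupLie Φ := fun {M} ↦ by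
    rw [hmem, φ.symm_apply_apply]
  have hbr : ∀ X ∈ 𝔤, ∀ Y ∈ 𝔤, X * Y - Y * X ∈ 𝔤 := fun X hX Y hY ↦ by
    rw [hmem, map_sub, map_mul, map_mul]
    have h := (hodgeGroupLie Φ).lie_mem (hmem.1 hX) (hmem.1 hY)
    rwa [Ring.lie_def] at h
  -- the trace form of `𝔥𝔤_ℝ` is non-degenerate: `tr(X X^†) > 0`
  have hsep : ∀ X ∈ 𝔤, (∀ Y ∈ 𝔤, LinearMap.trace ℝ (ι → ℝ) (X * Y) = 0) → X = 0 := fun X hX h ↦ by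
    by_contra hX0
    have hM0 : φ.symm X ≠ 0 := fun h0 ↦ hX0 (by rw [← φ.apply_symm_apply X, h0, map_zero])
    have hpos := trace_mul_formAdjoint_self_pos hη.posDef_hodgeFormR hM0
    have h1 := h (φ (formAdjoint (hodgeFormR Φ η) (φ.symm X)))
      (hmem'.2 (hη.formAdjoint_mem_hodgeGroupLie (hmem.1 hX)))
    have h2 : X * φ (formAdjoint (hodgeFormR Φ η) (φ.symm X)) =
        φ (φ.symm X * formAdjoint (hodgeFormR Φ η) (φ.symm X)) := by
      rw [map_mul, φ.apply_symm_apply]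
    rw [h2, htr] at h1
    exact hpos.ne' h1
  -- and anisotropic on the centre: a central `Z` commutes with `J`, so `Z^† = -Z`, `tr(Z²) = -tr(Z Z^†) < 0`
  have haniso : ∀ Z ∈ 𝔤, (∀ Y ∈ 𝔤, Z * Y = Y * Z) → LinearMap.trace ℝ (ι → ℝ) (Z * Z) = 0 → Z = 0 :=
      fun Z hZ hc h0 ↦ by
    by_contra hZ0
    set M := φ.symm Z with hM
    have hMg : M ∈ hodgeGroupLie Φ := hmem.1 hZ
    have hM0 : M ≠ 0 := fun h ↦ hZ0 (by rw [← φ.apply_symm_apply Z, ← hM, h, map_zero])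
    have hMJ : M * jMatrix Φ = jMatrix Φ * M := by
      have h := congrArg φ.symm (hc (φ (jMatrix Φ)) (hmem'.2 jMatrix_mem_hodgeGroupLie))
      rwa [map_mul, map_mul, φ.symm_apply_apply] at h
    have hadj : formAdjoint (hodgeFormR Φ η) M = -M := by
      rw [hη.formAdjoint_hodgeFormR_eq_neg_conj hMg, ← hMJ,
        Matrix.mul_nonsing_inv_cancel_right _ _ (isUnit_det_jMatrix Φ)]
    have hpos := trace_mul_formAdjoint_self_pos hη.posDef_hodgeFormR hM0
    rw [hadj, Matrix.mul_neg, Matrix.trace_neg] at hpos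
    have h0' : (M * M).trace = 0 := by
      rw [← htr, map_mul, hM, φ.apply_symm_apply]
      exact h0
    linarith
  obtain ⟨Z, hZ, hZc, D, hD, hJ⟩ := Literature.Algebra.Lie.TraceSeparating.exists_central_add_derived 𝔤 hbr hsep
    haniso (hmem'.2 (jMatrix_mem_hodgeGroupLie (Φ := Φ)))
  refine ⟨φ.symm Z, hmem.1 hZ, fun Y hY ↦ ?_, φ.symm D, ?_, ?_⟩
  · have h := congrArg φ.symm (hZc (φ Y) (hmem'.2 hY))
    rwa [map_mul, map_mul, φ.symm_apply_apply] at h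
  · have hle : Submodule.span ℝ {B | ∃ X ∈ 𝔤, ∃ Y ∈ 𝔤, X * Y - Y * X = B} ≤
        (Submodule.span ℝ
          {B : Matrix ι ι ℝ | ∃ X ∈ hodgeGroupLie Φ, ∃ Y ∈ hodgeGroupLie Φ, X * Y - Y * X = B}).comap
          (φ.symm.toLinearEquiv : Module.End ℝ (ι → ℝ) →ₗ[ℝ] Matrix ι ι ℝ) := by
      refine Submodule.span_le.2 ?_
      rintro _ ⟨X, hX, Y, hY, rfl⟩
      refine Submodule.subset_span ⟨φ.symm X, hmem.1 hX, φ.symm Y, hmem.1 hY, ?_⟩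
      change _ = φ.symm (X * Y - Y * X)
      rw [map_sub, map_mul, map_mul]
    exact hle hD
  · have h := congrArg φ.symm hJ
    rwa [φ.symm_apply_apply, map_add] at h

end Reductive

/-! ## §5 Zarhin's Theorem 2.3: `(n_σ)_σ ∈ 𝒞_X ⊗_ℚ ℂ` -/

section MultiplicitiesCenter

variable {Φ} {K : Type*} [Field K] [NumberField K] (f : K →ₐ[ℚ] Matrix ι ι ℚ) (hf : ∀ x, f x ∈ endAlgRat Φ)

/-- The `ℝ`-linear functional `X ↦ tr((X ⊗ 1) ∘ p)` on real matrices, for a fixed `p ∈ End(V_ℂ)`. [folklore] -/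
private theorem exists_linearMap_eq_trace_toLin'_mul (p : Module.End ℂ (ι → ℂ)) :
    ∃ Λ : Matrix ι ι ℝ →ₗ[ℝ] ℂ,
      ∀ X, Λ X = LinearMap.trace ℂ (ι → ℂ) (Matrix.toLin' (X.map Complex.ofRealHom) * p) := by
  refine ⟨{ toFun := fun X ↦ LinearMap.trace ℂ (ι → ℂ) (Matrix.toLin' (X.map Complex.ofRealHom) * p)
            map_add' := fun X Y ↦ ?_
            map_smul' := fun r X ↦ ?_ }, fun X ↦ rfl⟩
  · rw [Matrix.map_add _ Complex.ofRealHom.map_add, map_add, add_mul, map_add]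
  · simp only [RingHom.id_apply]
    have h : (r • X).map Complex.ofRealHom = (r : ℂ) • X.map Complex.ofRealHom := by
      ext i j
      simp [Matrix.map_apply]
    rw [h, map_smul, smul_mul_assoc, map_smul, smul_eq_mul, Complex.real_smul]

include hf in
/-- **ZARHIN'S THEOREM 2.3 (first assertion): `(n_σ)_{σ ∈ Σ_E} ∈ 𝒞_X ⊗_ℚ ℂ`** for a polarised complex torus `X`
(an abelian variety) and a subfield `E = f(K) ⊆ End⁰(X)` CONTAINING THE CENTRE `𝒞_X` of `End⁰(X)` — stated as what
membership in `𝒞_X ⊗_ℚ ℂ = {(u_σ) ∈ ∏_σ ℂ_σ = E ⊗_ℚ ℂ | u_σ = u_τ whenever σ|_{𝒞_X} = τ|_{𝒞_X}}` means: **the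
multiplicities `n_σ = dim_ℂ Lie(X)_σ` of two embeddings `σ, τ : E → ℂ` that agree on `𝒞_X` are equal.**
Proof as printed, with the Lie algebra `𝔥𝔤_ℝ ∋ J` of the Hodge group in place of `mt ∋ f_H` (`f_H = (i(J ⊗ 1) - 1)/2`):
`𝔥𝔤_ℝ` commutes with `E`, so `Tr_σ(X) = tr((X ⊗ 1)|_{V_σ})` is defined on it; `J = Z + D` with `Z` central and `D` a
combination of commutators (§4); `Tr_σ` kills commutators ("`Tr_E(mt^{ss}) = 0`"); `Z ∈ 𝒞_X ⊗ ℝ` ("the center `𝔠` of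
`mt` lies in `𝒞_Z`", the tree's `mem_span_center_endAlgRat_of_forall_hodgeGroupLie_comm`) and on `𝒞_X ⊆ E` one has
`Tr_σ(f(k) ⊗ 1) = σ(k) d`, the same for `σ` and `τ`; finally `Tr_σ(J ⊗ 1) = i(2 n_σ - d)` (§2).
[cite: Zarhin2004EndomorphismRingsCyclicCovers, §2 Thm. 2.3 (first assertion) and its proof (p0004–p0005)] -/
theorem IsRiemannForm.finrank_iInf_eigenspace_analyticRepHom_eq_of_center_subset {η : E [⋀^Fin 2]→L[ℝ] ℝ}
    (hη : IsRiemannForm Φ η)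
    (hcen : ∀ B ∈ endAlgRat Φ, (∀ C ∈ endAlgRat Φ, B * C = C * B) → B ∈ Set.range f)
    {σ τ : K →+* ℂ} (hστ : ∀ k : K, (∀ C ∈ endAlgRat Φ, f k * C = C * f k) → σ k = τ k) :
    finrank ℂ ↥(⨅ y : K, Module.End.eigenspace
        ((analyticRepHom Φ ⟨f y, hf y⟩ : E →L[ℂ] E) : E →ₗ[ℂ] E) (σ y)) =
      finrank ℂ ↥(⨅ y : K, Module.End.eigenspace
        ((analyticRepHom Φ ⟨f y, hf y⟩ : E →L[ℂ] E) : E →ₗ[ℂ] E) (τ y)) := by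
  classical
  -- the simultaneous eigenspaces `V_ρ ⊆ V_ℂ`, projectors `p_ρ` onto them, and the functionals `Λ_ρ(X) = tr((X ⊗ 1) p_ρ)`
  set V : (K →+* ℂ) → Submodule ℂ (ι → ℂ) := fun ρ ↦
    ⨅ y : K, Module.End.eigenspace (Matrix.toLin' ((f y).map (algebraMap ℚ ℂ))) (ρ y) with hV
  have hP : ∀ ρ, ∃ p : Module.End ℂ (ι → ℂ), LinearMap.IsProj (V ρ) p := fun ρ ↦ exists_isProj (V ρ)
  choose p hp using hP
  have hΛ := fun ρ ↦ exists_linearMap_eq_trace_toLin'_mul (ι := ι) (p ρ)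
  choose Λ hΛ using hΛ
  -- `𝔥𝔤_ℝ ⊗ 1` preserves each `V_ρ` (it commutes with `E ⊗ ℝ`)
  have hstab : ∀ ρ, ∀ X ∈ hodgeGroupLie Φ, ∀ v ∈ V ρ, Matrix.toLin' (X.map Complex.ofRealHom) v ∈ V ρ :=
    fun ρ X hX ↦ toLin'_map_mem_iInf_eigenspace_of_comm f (fun y ↦ map_ratCast_comm_of_mem_endAlgRat (hf y) hX) ρ
  -- `Λ_ρ` kills `[𝔥𝔤_ℝ, 𝔥𝔤_ℝ]`
  have hcomm : ∀ ρ, Submodule.span ℝ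
      {B : Matrix ι ι ℝ | ∃ X ∈ hodgeGroupLie Φ, ∃ Y ∈ hodgeGroupLie Φ, X * Y - Y * X = B} ≤
        LinearMap.ker (Λ ρ) := fun ρ ↦ by
    refine Submodule.span_le.2 ?_
    rintro _ ⟨X, hX, Y, hY, rfl⟩
    rw [SetLike.mem_coe, LinearMap.mem_ker, hΛ, Matrix.map_sub _ Complex.ofRealHom.map_sub, Matrix.map_mul,
      Matrix.map_mul, map_sub, Matrix.toLin'_mul, Matrix.toLin'_mul]
    exact trace_commutator_mul_eq_zero_of_isProj (hp ρ) (hstab ρ X hX) (hstab ρ Y hY)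
  -- `dim V_σ = dim V_τ = d = 2 dim X/[E:ℚ]`
  have hd : ∀ ρ, finrank ℂ ↥(V ρ) * finrank ℚ K = Fintype.card ι := fun ρ ↦
    finrank_iInf_eigenspace_toLin'_map_mul_finrank f ρ
  have hdeq : finrank ℂ ↥(V σ) = finrank ℂ ↥(V τ) :=
    Nat.eq_of_mul_eq_mul_right Module.finrank_pos ((hd σ).trans (hd τ).symm)
  -- on `𝒞_X ⊗ ℝ ⊆ E ⊗ ℝ`: `Λ_ρ(f(k) ⊗ 1) = ρ(k) d`, and `σ = τ` on `f⁻¹(𝒞_X)`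
  have hgen : ∀ ρ (k : K), Λ ρ ((f k).map ((↑) : ℚ → ℝ)) = ρ k * (finrank ℂ ↥(V ρ) : ℂ) := fun ρ k ↦ by
    rw [hΛ, map_ratCast_map_ofRealHom]
    exact trace_mul_eq_mul_finrank_of_isProj (hp ρ) fun v hv ↦
      Module.End.mem_eigenspace_iff.1 ((Submodule.mem_iInf _).1 hv k)
  have hcentral : Set.EqOn (Λ σ) (Λ τ) ((fun B : Matrix ι ι ℚ ↦ B.map ((↑) : ℚ → ℝ)) ''
      {B : Matrix ι ι ℚ | B ∈ endAlgRat Φ ∧ ∀ C ∈ endAlgRat Φ, B * C = C * B}) := by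
    rintro _ ⟨B, ⟨hB, hBc⟩, rfl⟩
    obtain ⟨k, rfl⟩ := hcen B hB hBc
    simp only [hgen, hdeq, hστ k hBc]
  -- `J = Z + D`: `Λ_σ(J) = Λ_σ(Z) = Λ_τ(Z) = Λ_τ(J)`
  obtain ⟨Z, hZ, hZc, D, hD, hJ⟩ := hη.exists_central_add_mem_span_commutator_eq_jMatrix
  have hZspan := mem_span_center_endAlgRat_of_forall_hodgeGroupLie_comm Φ hZ hZc
  have hΛJ : Λ σ (jMatrix Φ) = Λ τ (jMatrix Φ) := by
    have hDσ : Λ σ D = 0 := LinearMap.mem_ker.1 (hcomm σ hD)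
    have hDτ : Λ τ D = 0 := LinearMap.mem_ker.1 (hcomm τ hD)
    rw [hJ, map_add, map_add, hDσ, hDτ, LinearMap.eqOn_span' hcentral hZspan]
  -- `Λ_ρ(J) = tr(J ⊗ 1 | V_ρ) = i (2 n_ρ - d)`
  have htrJ : ∀ ρ, Λ ρ (jMatrix Φ) = Complex.I * (2 * (finrank ℂ ↥(⨅ y : K, Module.End.eigenspace
      ((analyticRepHom Φ ⟨f y, hf y⟩ : E →L[ℂ] E) : E →ₗ[ℂ] E) (ρ y)) : ℂ) - (finrank ℂ ↥(V ρ) : ℂ)) := fun ρ ↦ by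
    rw [hΛ, trace_mul_eq_trace_restrict_of_isProj (hp ρ) (hstab ρ _ jMatrix_mem_hodgeGroupLie),
      trace_restrict_toLin'_jMatrix_iInf_eigenspace Φ f hf ρ]
  rw [htrJ, htrJ, hdeq] at hΛJ
  have h3 : (2 : ℂ) * _ = 2 * _ := sub_left_injective (mul_left_cancel₀ Complex.I_ne_zero hΛJ)
  exact_mod_cast mul_left_cancel₀ two_ne_zero h3

include hf in
/-- **`n_σ = n_σ̄ = d/2`, i.e. `2 n_σ [E:ℚ] = 2 dim X`, as soon as `σ(𝒞_X) ⊆ ℝ`** (polarised complex torus,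
`E = f(K) ⊇ 𝒞_X`): `σ` and `σ̄` then agree on `𝒞_X`, so `n_σ = n_σ̄` by Theorem 2.3, and `n_σ + n_σ̄ = d`
(Remark 2.1, the tree's `finrank_iInf_eigenspace_analyticRepHom_add_conjugate_mul_finrank`). This is how
Theorem 2.3 is used: "Since the center `𝒞` of `End⁰(J^{(f,p)})` is totally real, the Hodge group of `J^{(f,p)}`
must be semisimple. This implies that the pair `(J^{(f,p)}, ℚ(δ_p))` is of Weil type ([MZ]), i.e. […]
`n_σ = dim(J^{(f,p)})/[ℚ(δ_p):ℚ]`" (the tree's `finrank_iInf_eigenspace_analyticRepHom_conjugate_eq_of_center_real`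
has this for `K` CM and `f(K)` MAXIMAL commutative, by Skolem–Noether; here `𝒞_X ⊆ f(K)` and one `σ` suffice).
[cite: Zarhin2004EndomorphismRingsCyclicCovers, §2 Thm. 2.3 and Rem. 2.1 (p0004)]
[cite: Zarhin2002CyclicCovers, §3 Thm 3.8 (i) (proof, p0008)] [cite: MoonenZarhin1998WeilClasses, (3), (5)] -/
theorem IsRiemannForm.two_mul_finrank_iInf_eigenspace_analyticRepHom_mul_finrank_of_center_subset
    [FiniteDimensional ℂ E] {η : E [⋀^Fin 2]→L[ℝ] ℝ} (hη : IsRiemannForm Φ η)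
    (hcen : ∀ B ∈ endAlgRat Φ, (∀ C ∈ endAlgRat Φ, B * C = C * B) → B ∈ Set.range f) {σ : K →+* ℂ}
    (hreal : ∀ k : K, (∀ C ∈ endAlgRat Φ, f k * C = C * f k) → starRingEnd ℂ (σ k) = σ k) :
    2 * finrank ℂ ↥(⨅ y : K, Module.End.eigenspace
        ((analyticRepHom Φ ⟨f y, hf y⟩ : E →L[ℂ] E) : E →ₗ[ℂ] E) (σ y)) * finrank ℚ K = Fintype.card ι := by
  have hστ : ∀ k : K, (∀ C ∈ endAlgRat Φ, f k * C = C * f k) →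
      σ k = NumberField.ComplexEmbedding.conjugate σ k := fun k hk ↦ by
    rw [NumberField.ComplexEmbedding.conjugate_coe_eq, hreal k hk]
  have h := hη.finrank_iInf_eigenspace_analyticRepHom_eq_of_center_subset f hf hcen hστ
  have h2 := finrank_iInf_eigenspace_analyticRepHom_add_conjugate_mul_finrank Φ f hf σ
  rwa [← h, ← two_mul] at h2

include hf in
/-- **COROLLARY (`𝒞_X = ℚ`): `2 n_σ [E:ℚ] = 2 dim X` for EVERY `σ`** — if the centre of `End⁰(X)` is `ℚ`
(`End⁰(X)` a central simple `ℚ`-algebra) then `(n_σ)_σ ∈ ℚ ⊗ ℂ = ℂ·(1, …, 1)`: all the multiplicities of any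
subfield `E ⊆ End⁰(X)` coincide, `n_σ = d/2`. [cite: Zarhin2004EndomorphismRingsCyclicCovers, §2 Thm. 2.3 and Rem. 2.1 (p0004)] -/
theorem IsRiemannForm.two_mul_finrank_iInf_eigenspace_analyticRepHom_mul_finrank_of_center_eq_bot [Nonempty ι]
    [FiniteDimensional ℂ E] {η : E [⋀^Fin 2]→L[ℝ] ℝ} (hη : IsRiemannForm Φ η)
    (hcen : ∀ B ∈ endAlgRat Φ, (∀ C ∈ endAlgRat Φ, B * C = C * B) → ∃ q : ℚ, B = algebraMap ℚ (Matrix ι ι ℚ) q)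
    (σ : K →+* ℂ) :
    2 * finrank ℂ ↥(⨅ y : K, Module.End.eigenspace
        ((analyticRepHom Φ ⟨f y, hf y⟩ : E →L[ℂ] E) : E →ₗ[ℂ] E) (σ y)) * finrank ℚ K = Fintype.card ι := by
  refine hη.two_mul_finrank_iInf_eigenspace_analyticRepHom_mul_finrank_of_center_subset f hf
    (fun B hB hBc ↦ ?_) fun k hk ↦ ?_
  · obtain ⟨q, rfl⟩ := hcen B hB hBc
    exact ⟨algebraMap ℚ K q, f.commutes q⟩
  · obtain ⟨q, hq⟩ := hcen (f k) (hf k) hk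
    have hkq : k = algebraMap ℚ K q :=
      (f : K →+* Matrix ι ι ℚ).injective (by rw [RingHom.coe_coe, hq, f.commutes])
    rw [hkq, eq_ratCast, map_ratCast, map_ratCast]

end MultiplicitiesCenter

end ComplexTorus

end Literature.Geometry.Kaehler

end
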